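import Mathlib.Combinatorics.SetFamily.LYM
import Mathlib.Data.Nat.Choose.Central
import Mathlib.Tactic.LinearCombination
import Literature.Combinatorics.HalesJewett.DKTSubspaces
import HarnessLib

/-!
# The density Hales–Jewett property for small alphabets: `k ≤ 1` (trivial) and `k = 2` (Sperner)

Topic `Literature/Combinatorics/HalesJewett`. The base cases of the induction on the size `k` of
the alphabet in the proof of the density Hales–Jewett theorem (the tree's named fact
`DensityHalesJewett`, file `DensityHalesJewett.lean`; induction predicate `DHJ α` of
`DKTSubspaces.lean`) along P. Dodos, V. Kanellopoulos, K. Tyros, *A simple proof of the density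
Hales–Jewett theorem*, IMRN 2014 (= arXiv:1209.4986), §4: "The case `k = 2` follows from the
classical Sperner Theorem [Sp]"; D. H. J. Polymath, Ann. of Math. 175 (2012), §2 (p. 1290): a pair
`A ⊂ B` of subsets of `[n]` "corresponds to a combinatorial line in `{0,1}^n`", and Sperner's bound
`|𝒜| ≤ (n choose ⌊n/2⌋)` for an antichain `𝒜`.

* `DHJ.of_equiv` — `DHJ` is invariant under relabelling the alphabet (used to pass between
  `Option (Fin k)` and `Fin (k + 1)` in the inductive step, and between `α` and `Fin |α|`).
* `dhj_of_card_le_one` — alphabets with at most one letter (`N = 1`, the diagonal line).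
* `dhj_fin_two`, `dhj_of_card_eq_two` — **DHJ₂ from Sperner's theorem**: a line-free
  `A ⊆ {0,1}^ι` is an antichain under `w ↦ {i : w i = 1}` (`binary_line_iff_ssubset`), so
  `#A ≤ (n choose ⌊n/2⌋)` by Mathlib's `IsAntichain.sperner` (the LYM inequality), and
  `(n choose ⌊n/2⌋) < δ 2^n` for large `n` (`exists_middleBinomial_lt`, from the elementary
  estimate `((2m choose m)/4^m)^2 (3m+1) ≤ 1`, `centralBinom_ratio_sq_mul_le`, proved by induction
  on `m` — no Stirling).

The combinatorial part (`binarySupport`, `binary_line_iff_ssubset`, `binarySupport_injective`,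
`centralBinom_ratio_sq_mul_le`, `middleBinomial_ratio_le_central`) is ported, with the coordinate
type generalised from `Fin n` to a finite type `ι` and restated for the tree's predicate `DHJ`,
from `DensityHalesJewett/Main.lean` of the Apache-2.0 Lean 4 development
github.com/gdahia/DensityHalesJewett @ 27e0e64 (G. Dahia 2026, a formalization of DKT 2014);
`exists_middleBinomial_lt` is given a square-root-free proof here.

## References
* E. Sperner, *Ein Satz über Untermengen einer endlichen Menge*, Math. Z. 27 (1928), 544–548.
* D. H. J. Polymath, Ann. of Math. 175 (2012), 1283–1327, §2 (Thm 2.1, Sperner–Lubell).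
  [cite: Polymath2012DHJ]
* P. Dodos, V. Kanellopoulos, K. Tyros, IMRN 2014 (12), 3340–3352, §4 (case `k = 2`).
  [cite: DodosKanellopoulosTyros2014]
-/

open Finset Combinatorics

namespace Literature.Combinatorics.HalesJewett

/-! ### Relabelling the alphabet -/

/-- `DHJ` is invariant under a bijection of alphabets: pull the set of words back along
`e : α ≃ β` (density is preserved) and push the line forward with `Line.map e`. [folklore] -/
theorem DHJ.of_equiv {α β : Type} [Fintype α] [Fintype β] (e : α ≃ β) (h : DHJ α) : DHJ β := by
  intro δ hδ
  obtain ⟨N, hN⟩ := h δ hδ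
  refine ⟨N, fun ι _ _ hι A hA => ?_⟩
  classical
  set f : (ι → β) ≃ (ι → α) := (Equiv.refl ι).arrowCongr e.symm with hf
  set A' : Finset (ι → α) := A.map f.toEmbedding with hA'
  have hdens : rdens A' = rdens A := by
    rw [rdens_def, rdens_def, hA', card_map, Fintype.card_fun, Fintype.card_fun,
      Fintype.card_congr e]
  obtain ⟨l, hl⟩ := hN ι hι A' (by rw [hdens]; exact hA)
  refine ⟨l.map e, fun b => ?_⟩
  have hb : (l.map e) b = e ∘ l (e.symm b) := by
    conv_lhs => rw [← e.apply_symm_apply b]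
    exact Line.map_apply e l (e.symm b)
  have hmem := hl (e.symm b)
  rw [hA', mem_map_equiv] at hmem
  rw [hb]
  convert hmem using 1
  funext i
  simp [hf, Equiv.arrowCongr]

/-! ### Alphabets with at most one letter -/

/-- **DHJ for `k ≤ 1`** (DKT: "DHJ₁ is trivial"; Polymath 2012, §9.1): over an alphabet with at
most one letter every nonempty set of words of a nonempty cube contains the (unique) line, so
`N = 1` works. [cite: Polymath2012DHJ, §9.1 ("DHJ_1 is trivial")] -/
theorem dhj_of_card_le_one {α : Type} [Fintype α] (hα : Fintype.card α ≤ 1) : DHJ α := by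
  intro δ hδ
  refine ⟨1, fun ι _ _ hι A hA => ?_⟩
  classical
  haveI : Subsingleton α := Fintype.card_le_one_iff_subsingleton.mp hα
  haveI : Nonempty ι := Fintype.card_pos_iff.mp (by omega)
  have hAne : A.Nonempty := by
    rw [nonempty_iff_ne_empty]
    rintro rfl
    rw [rdens_eq_cast_dens, dens_empty, NNRat.cast_zero] at hA
    exact absurd hA (not_le.mpr hδ)
  obtain ⟨w, hw⟩ := hAne
  refine ⟨Line.diagonal α ι, fun a => ?_⟩
  rwa [Subsingleton.elim (Line.diagonal α ι a) w]

/-! ### Two letters: Sperner's theorem -/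

/-- Identify a binary word with the set of coordinates on which it equals `1`.
[cite: Polymath2012DHJ, §2 (p. 1290)] -/
def binarySupport {ι : Type*} [Fintype ι] (w : ι → Fin 2) : Finset ι :=
  Finset.univ.filter fun i ↦ w i = 1

/-- Two binary words are the points `ℓ(0), ℓ(1)` of a combinatorial line exactly when their
supports are strictly nested (Polymath 2012, §2: "a pair `(A, B)` with `A ⊂ B` corresponds to a
combinatorial line in `{0,1}^n`"). [cite: Polymath2012DHJ, §2 (p. 1290)] -/
lemma binary_line_iff_ssubset {ι : Type*} [Fintype ι] (x y : ι → Fin 2) :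
    (∃ l : Combinatorics.Line (Fin 2) ι, l 0 = x ∧ l 1 = y) ↔
      binarySupport x ⊂ binarySupport y := by
  have hmem : ∀ (w : ι → Fin 2) (j : ι), j ∈ binarySupport w ↔ w j = 1 := by simp [binarySupport]
  constructor
  · rintro ⟨l, rfl, rfl⟩
    obtain ⟨i, hi⟩ := l.proper
    refine (ssubset_iff_of_subset ?_).2 ⟨i, by simp [hmem, hi], by simp [hmem, hi]⟩
    intro j hj
    cases hj' : l.idxFun j <;> simp_all
  · intro h
    obtain ⟨i, hiy, hix⟩ := exists_of_ssubset h
    have hsub : ∀ j, x j = 1 → y j = 1 := by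
      intro j hj
      exact (hmem y j).1 (h.1 ((hmem x j).2 hj))
    refine ⟨⟨fun j ↦ if x j = y j then some (x j) else none, i, by grind⟩, ?_, ?_⟩ <;>
      funext j <;> grind [Combinatorics.Line.coe_apply]

/-- The support determines the binary word. [folklore] -/
lemma binarySupport_injective {ι : Type*} [Fintype ι] :
    Function.Injective (binarySupport : (ι → Fin 2) → Finset ι) := by
  intro x y hxy
  funext i
  apply Fin.ext
  have hi : x i = 1 ↔ y i = 1 := by
    simpa only [binarySupport, mem_filter, mem_univ, true_and] using Finset.ext_iff.mp hxy i
  grind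

/-- The elementary estimate `((2m choose m) / 4^m)^2 · (3m + 1) ≤ 1` for the central binomial
coefficient (induction on `m` with `(m+1) C_{m+1} = 2(2m+1) C_m`). [folklore] -/
lemma centralBinom_ratio_sq_mul_le (m : ℕ) :
    ((Nat.centralBinom m : ℝ) / 4 ^ m) ^ 2 * (3 * m + 1) ≤ 1 := by
  induction m with
  | zero => norm_num [Nat.centralBinom]
  | succ m ih =>
      have hrec : ((m + 1 : ℕ) : ℝ) * Nat.centralBinom (m + 1) =
          2 * (2 * m + 1) * Nat.centralBinom m := by
        exact_mod_cast Nat.succ_mul_centralBinom_succ m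
      have hratio : (Nat.centralBinom (m + 1) : ℝ) / 4 ^ (m + 1) =
          ((Nat.centralBinom m : ℝ) / 4 ^ m) *
            ((2 * m + 1 : ℝ) / (2 * (m + 1))) := by
        rw [pow_succ]
        field_simp
        push_cast at hrec ⊢
        linear_combination 2 * hrec
      rw [hratio, mul_pow, mul_assoc]
      refine le_trans (mul_le_mul_of_nonneg_left ?_ (sq_nonneg _)) ih
      rw [div_pow, div_mul_eq_mul_div]
      apply (div_le_iff₀ (sq_pos_of_pos (by positivity))).mpr
      push_cast
      ring_nf
      nlinarith

/-- `2^(2m) = 4^m` in `ℝ`. [folklore] -/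
private lemma two_pow_two_mul (m : ℕ) : (2 : ℝ) ^ (2 * m) = 4 ^ m := by
  rw [pow_mul]
  norm_num

/-- The normalised middle binomial coefficient `(n choose ⌊n/2⌋)/2^n` is at most the normalised
central binomial coefficient `(2m choose m)/4^m`, `m = ⌊n/2⌋`. [folklore] -/
lemma middleBinomial_ratio_le_central (n : ℕ) :
    (n.choose (n / 2) : ℝ) / 2 ^ n ≤
      (Nat.centralBinom (n / 2) : ℝ) / 4 ^ (n / 2) := by
  obtain ⟨m, hm | hm⟩ := Nat.even_or_odd' n
  · subst n
    have hdiv : 2 * m / 2 = m := by grind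
    rw [hdiv, Nat.centralBinom, two_pow_two_mul]
  · subst n
    have hdiv : (2 * m + 1) / 2 = m := by grind
    rw [hdiv, Nat.centralBinom]
    cases m with
    | zero => norm_num
    | succ m =>
      have hchoose : (2 * (m + 1) + 1).choose (m + 1) ≤
          2 * Nat.centralBinom (m + 1) := by
        rw [Nat.choose_succ_left (2 * (m + 1)) (m + 1) (by grind)]
        simpa only [Nat.add_sub_cancel, two_mul] using
          add_le_add (Nat.choose_le_centralBinom m (m + 1))
            (Nat.choose_le_centralBinom (m + 1) (m + 1))
      rw [pow_succ, two_pow_two_mul, mul_comm (4 ^ (m + 1) : ℝ) 2]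
      apply le_trans (b := (2 * Nat.centralBinom (m + 1) : ℝ) /
        (2 * 4 ^ (m + 1)))
      · exact (div_le_div_iff_of_pos_right
          (by positivity : (0 : ℝ) < 2 * 4 ^ (m + 1))).mpr <| by
            exact_mod_cast hchoose
      · field_simp
        rfl

/-- The middle layer of the Boolean cube eventually has proportion `< δ`:
`(n choose ⌊n/2⌋) < δ 2^n` for `n ≥ N(δ)` (here `N = 2 (⌊1/δ²⌋ + 1)`, from
`centralBinom_ratio_sq_mul_le`). [folklore] -/
lemma exists_middleBinomial_lt (δ : ℝ) (hδ : 0 < δ) :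
    ∃ N, ∀ n, N ≤ n → (n.choose (n / 2) : ℝ) < δ * 2 ^ n := by
  obtain ⟨M, hM⟩ := exists_nat_gt (1 / δ ^ 2)
  refine ⟨2 * M, fun n hn => ?_⟩
  have hMn : M ≤ n / 2 := by omega
  have h1 := centralBinom_ratio_sq_mul_le (n / 2)
  have h2 := middleBinomial_ratio_le_central n
  have hm : 1 / δ ^ 2 < 3 * ((n / 2 : ℕ) : ℝ) + 1 := by
    have : (M : ℝ) ≤ ((n / 2 : ℕ) : ℝ) := by exact_mod_cast hMn
    linarith
  have hr : (Nat.centralBinom (n / 2) : ℝ) / 4 ^ (n / 2) < δ := by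
    by_contra hcon
    have hle : δ ≤ (Nat.centralBinom (n / 2) : ℝ) / 4 ^ (n / 2) := le_of_not_gt hcon
    have hsq : δ ^ 2 ≤ ((Nat.centralBinom (n / 2) : ℝ) / 4 ^ (n / 2)) ^ 2 :=
      pow_le_pow_left₀ hδ.le hle 2
    have h3 : δ ^ 2 * (3 * ((n / 2 : ℕ) : ℝ) + 1) ≤ 1 :=
      le_trans (mul_le_mul_of_nonneg_right hsq (by positivity)) h1
    have h4 : 1 < δ ^ 2 * (3 * ((n / 2 : ℕ) : ℝ) + 1) := by
      rw [div_lt_iff₀ (by positivity)] at hm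
      linarith
    linarith
  have h5 : (n.choose (n / 2) : ℝ) / 2 ^ n < δ := lt_of_le_of_lt h2 hr
  rwa [div_lt_iff₀ (by positivity)] at h5

/-- **DHJ₂ = Sperner** (DKT 2014, §4: "the case `k = 2` follows from the classical Sperner
theorem"; Polymath 2012, §2): a line-free `A ⊆ {0,1}^ι` is an antichain of supports, hence has at
most `(n choose ⌊n/2⌋) < δ 2^n` elements once `n = |ι|` is large.
[cite: DodosKanellopoulosTyros2014, §4 (case k = 2, from Sperner's theorem)] -/
theorem dhj_fin_two : DHJ (Fin 2) := by
  intro δ hδ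
  obtain ⟨N, hN⟩ := exists_middleBinomial_lt δ hδ
  refine ⟨N, fun ι _ _ hι A hA => ?_⟩
  classical
  by_contra hline
  let B : Finset (Finset ι) := A.image binarySupport
  have hB : IsAntichain (· ⊆ ·) (B : Set (Finset ι)) := by
    intro s hs t ht hst hsub
    obtain ⟨x, hx, rfl⟩ := Finset.mem_image.mp (Finset.mem_coe.mp hs)
    obtain ⟨y, hy, rfl⟩ := Finset.mem_image.mp (Finset.mem_coe.mp ht)
    apply hline
    obtain ⟨l, hlx, hly⟩ := (binary_line_iff_ssubset x y).2 <|
      Finset.ssubset_iff_subset_ne.2 ⟨hsub, hst⟩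
    refine ⟨l, fun a => ?_⟩
    obtain rfl | ⟨i, rfl⟩ := a.eq_zero_or_eq_succ
    · rw [hlx]
      exact hx
    · simp only [Fin.eq_zero i]
      change l 1 ∈ A
      rwa [hly]
  have hcard : #A ≤ (Fintype.card ι).choose (Fintype.card ι / 2) := by
    rw [← Finset.card_image_of_injective A binarySupport_injective]
    exact hB.sperner
  have hcardR : (#A : ℝ) ≤ (Fintype.card ι).choose (Fintype.card ι / 2) := by exact_mod_cast hcard
  have hK : (Fintype.card (ι → Fin 2) : ℝ) = 2 ^ Fintype.card ι := by
    rw [Fintype.card_fun, Fintype.card_fin]; push_cast; ring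
  have hAδ : δ * 2 ^ Fintype.card ι ≤ #A := by
    have h := hA
    rw [rdens_def, hK, le_div_iff₀ (by positivity)] at h
    exact h
  linarith [hN (Fintype.card ι) hι]

/-- **DHJ over any two-letter alphabet** (from `dhj_fin_two` by `DHJ.of_equiv`).
[cite: DodosKanellopoulosTyros2014, §4 (case k = 2, from Sperner's theorem)] -/
theorem dhj_of_card_eq_two {α : Type} [Fintype α] (hα : Fintype.card α = 2) : DHJ α := by
  classical
  exact DHJ.of_equiv ((Fintype.equivFin α).trans (finCongr hα)).symm dhj_fin_two

end Literature.Combinatorics.HalesJewett
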